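import Literature.NumberTheory.Rogawski1990.SingularClassOccursInAnisotropic
import Literature.NumberTheory.Rogawski1990.AnisotropicUnitarySemisimple
import HarnessLib

/-!
# A stable class of `H = U(J₂) × U(J₁)` that TRANSFERS to an anisotropic inner form has SEMISIMPLE image; for the non-`G`-regular
# classes this is an equivalence (Rogawski (1990), §14.1 p. 232, §14.5 pp. 237–239, §5.4 Prop. 5.4.1 p. 77)

Topic `NumberTheory/Rogawski1990`; namespace `Literature.NumberTheory.Rogawski1990`.  THEOREMS ONLY (no definition, no instance, no notation, no
named fact, no `sorry`).  Cell `pub/hodgecm-mathlib`, ENGINE T1 (crux H413), law T1b-VANISH: the ENGINE line's value pin (xiii-0) asks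
`SJ_H(𝒪_H, ·) = 0` at the stable classes of `H(L⁺)` whose image class in `U(Φ₃)` is NOT semisimple; this file records that these are classes which
transfer to NO class of the anisotropic inner form `G′ = U(H′)` (so the pin binds `SJ_H` only where T1b-VANISH reads it), and that among the
non-`G`-regular classes they are EXACTLY the non-transferring ones (the converse being ★ `StableClassH.exists_transfersTo_of_not_isGRegular`).

THE MATHEMATICS.  Corresponding elements `γ′ ↔ γ` are conjugate in `GL_n`, so semisimple together (★ `Corresponds.isSemisimpleElt_iff`); every
element of the unitary group of an ANISOTROPIC hermitian form is semisimple (★ `isSemisimpleElt_of_anisotropic`, [Rogawski1990, §14.5 p. 237]: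
«since `G′` is anisotropic … every `γ ∈ G′` is semisimple»).  Hence a stable class of `U(H)` corresponding to a class of `U(H′)`, `H′` anisotropic,
is semisimple; in the endoscopic reading (★ `StableClassH.TransfersTo h c′ c := (c′.endoImage h).Corresponds c`) a transferring class of
`H = U(J₂) × U(J₁)` has semisimple image class `ι(𝒪_H)`.

* §1 (any commutative ring) `StableClass.Corresponds.isSemisimple_iff`, `StableClassH.TransfersTo.isSemisimple_endoImage_iff`.
* §2 (field, anisotropic target) `StableClass.Corresponds.isSemisimple_of_anisotropic`, **`StableClassH.TransfersTo.isSemisimple_endoImage_of_anisotropic`**,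
  **`StableClassH.forall_not_transfersTo_of_not_isSemisimple`**.
* §3 (CM, `3 × 3`) **`StableClassH.exists_transfersTo_iff_isSemisimple_of_not_isGRegular`**: for `J₃`, `H′` non-degenerate hermitian, `H′` anisotropic,
  a NON-`G`-regular stable class of `H` transfers to some class of `U(H′)` iff its image class is semisimple.
HC_CM is proved only modulo the printed citations until rung 0 closes; this file is count-neutral linear algebra over ★ currency.

## References
* [Rogawski1990] J. D. Rogawski, *Automorphic Representations of Unitary Groups in Three Variables*, Ann. of Math. Stud. 123 (1990), §3.1 p. 19;
  §5.4 Prop. 5.4.1 p. 77; §14.1 p. 232; §14.5 pp. 237–239.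
-/

set_option autoImplicit false

noncomputable section

open scoped MatrixGroups Matrix

namespace Literature.NumberTheory.Rogawski1990

open Literature.AlgebraicGeometry.ShimuraVarieties (unitaryGroup hermForm)
open Literature.NumberTheory.Automorphic (cmConjRingHom)

/-! ## §1 Semisimplicity is shared along a correspondence ∕ a transfer of stable classes -/

section General

variable {R : Type*} [CommRing R] {n : Type*} [Fintype n] [DecidableEq n] {σ : R →+* R} {H H' : Matrix n n R}

/-- Corresponding stable classes are semisimple together (★ `Corresponds.isSemisimpleElt_iff` on representatives). [cite: Rogawski1990, §14.1 p. 232] -/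
theorem StableClass.Corresponds.isSemisimple_iff {c' : StableClass σ H'} {c : StableClass σ H} (h : c'.Corresponds c) :
    c'.IsSemisimple ↔ c.IsSemisimple := by
  obtain ⟨γ', rfl⟩ := stableClassOf_surjective c'
  obtain ⟨γ, rfl⟩ := stableClassOf_surjective c
  rw [StableClass.isSemisimple_stableClassOf, StableClass.isSemisimple_stableClassOf]
  exact Rogawski1990.Corresponds.isSemisimpleElt_iff (StableClass.corresponds_stableClassOf.mp h)

variable {J₂ : Matrix (Fin 2) (Fin 2) R} {J₁ : Matrix (Fin 1) (Fin 1) R} {J₃ J₃' : Matrix (Fin 3) (Fin 3) R}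

/-- If `𝒪_H ↦ 𝒪` (★ `StableClassH.TransfersTo`), the image class `ι(𝒪_H)` in `U(J₃)` is semisimple iff `𝒪` is. [cite: Rogawski1990, §5.4 Prop. 5.4.1 p. 77] -/
theorem StableClassH.TransfersTo.isSemisimple_endoImage_iff {h : endoForm J₂ J₁ = J₃} {c' : StableClassH σ J₂ J₁} {c : StableClass σ J₃'}
    (ht : c'.TransfersTo J₃' h c) : (c'.endoImage h).IsSemisimple ↔ c.IsSemisimple :=
  StableClass.Corresponds.isSemisimple_iff ht

end General

/-! ## §2 Anisotropic target: transferring classes have semisimple image -/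

section Anisotropic

variable {L : Type*} [Field L] {n : Type*} [Fintype n] [DecidableEq n] {σ : L →+* L} {H H' : Matrix n n L}

/-- A stable class of `U(H)` that corresponds to a class of `U(H′)` with `H′` ANISOTROPIC is semisimple (every element of `U(H′)` is, ★
`isSemisimpleElt_of_anisotropic`). [cite: Rogawski1990, §14.5 p. 237; §14.1 p. 232] -/
theorem StableClass.Corresponds.isSemisimple_of_anisotropic (hanis : ∀ x : n → L, hermForm σ H' x x = 0 → x = 0)
    {c : StableClass σ H} {c' : StableClass σ H'} (h : c.Corresponds c') : c.IsSemisimple :=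
  (StableClass.Corresponds.isSemisimple_iff h).mpr (StableClass.isSemisimple_of_anisotropic σ H' hanis c')

variable {J₂ : Matrix (Fin 2) (Fin 2) L} {J₁ : Matrix (Fin 1) (Fin 1) L} {J₃ : Matrix (Fin 3) (Fin 3) L} {H₃ : Matrix (Fin 3) (Fin 3) L}

/-- **A class of `H = U(J₂) × U(J₁)` transferring to a class of the ANISOTROPIC inner form `U(H₃)` has semisimple image class `ι(𝒪_H)`.**
[cite: Rogawski1990, §14.5 pp. 237–239; §5.4 Prop. 5.4.1 p. 77] -/
theorem StableClassH.TransfersTo.isSemisimple_endoImage_of_anisotropic (hanis : ∀ x : Fin 3 → L, hermForm σ H₃ x x = 0 → x = 0)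
    {h : endoForm J₂ J₁ = J₃} {c' : StableClassH σ J₂ J₁} {c : StableClass σ H₃} (ht : c'.TransfersTo H₃ h c) :
    (c'.endoImage h).IsSemisimple :=
  StableClass.Corresponds.isSemisimple_of_anisotropic hanis ht

/-- **A class of `H` whose image class is NOT semisimple transfers to NO class of an anisotropic inner form** — the classes at which the ENGINE
line's value pin (xiii-0) binds `SJ_H` are non-transferring, i.e. exactly where law T1b-VANISH reads it. [cite: Rogawski1990, §14.5 pp. 237–239; §5.4 Prop. 5.4.1 p. 77] -/
theorem StableClassH.forall_not_transfersTo_of_not_isSemisimple (hanis : ∀ x : Fin 3 → L, hermForm σ H₃ x x = 0 → x = 0)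
    {h : endoForm J₂ J₁ = J₃} {c' : StableClassH σ J₂ J₁} (hns : ¬ (c'.endoImage h).IsSemisimple) :
    ∀ c : StableClass σ H₃, ¬ c'.TransfersTo H₃ h c :=
  fun _ ht => hns (ht.isSemisimple_endoImage_of_anisotropic hanis)

end Anisotropic

/-! ## §3 CM reading: among the non-`G`-regular classes, «transfers» ⟺ «semisimple image» -/

section CM

open NumberField

variable {L : Type} [Field L] [NumberField L] [IsCMField L]
  {J₂ : Matrix (Fin 2) (Fin 2) L} {J₁ : Matrix (Fin 1) (Fin 1) L} {J₃ : Matrix (Fin 3) (Fin 3) L}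

/-- **For a NON-`G`-regular stable class `𝒪_H` of `H = U(J₂) × U(J₁)` (`endoForm J₂ J₁ = J₃`, `J₃` non-degenerate hermitian) and an ANISOTROPIC
non-degenerate hermitian `H′ ∈ M₃(L)`: `𝒪_H` transfers to some stable class of `U(H′)(L⁺)` iff its image class `ι(𝒪_H)` is semisimple** (⇒ §2;
⇐ ★ `StableClassH.exists_transfersTo_of_not_isGRegular`, the singular semisimple classes occur in every inner form).  At the `G`-REGULAR classes the
image is always semisimple and occurrence is instead governed by the archimedean match (★ `OccurrenceOfArchMatch`).
[cite: Rogawski1990, §14.5 pp. 237–239; §14.1 p. 232; §3.8 Prop. 3.8.1 p. 27] -/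
theorem StableClassH.exists_transfersTo_iff_isSemisimple_of_not_isGRegular (h : endoForm J₂ J₁ = J₃)
    (hJ₃ : (J₃.map (cmConjRingHom L))ᵀ = J₃) (hdet₃ : J₃.det ≠ 0)
    (H' : Matrix (Fin 3) (Fin 3) L) (hH' : (H'.map (cmConjRingHom L))ᵀ = H') (hdet' : H'.det ≠ 0)
    (hanis : ∀ x : Fin 3 → L, hermForm (cmConjRingHom L) H' x x = 0 → x = 0)
    (𝒪H : StableClassH (cmConjRingHom L) J₂ J₁) (hnreg : ¬ 𝒪H.IsGRegular h) :
    (∃ 𝒪 : StableClass (cmConjRingHom L) H', 𝒪H.TransfersTo H' h 𝒪) ↔ (𝒪H.endoImage h).IsSemisimple :=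
  ⟨fun ⟨_, ht⟩ => ht.isSemisimple_endoImage_of_anisotropic hanis,
    fun hss => StableClassH.exists_transfersTo_of_not_isGRegular h hJ₃ hdet₃ H' hH' hdet' 𝒪H hnreg hss⟩

end CM

end Literature.NumberTheory.Rogawski1990

end
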